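/-
Copyright (c) 2026 the pub-hodgecm-mathlib formalisation cell (harness21).  Prover seat hodgecm-mathlib-K2E1-p10 (g5), Track B «K2-LIT», h413 = `stmt-HodgeConjecture-24833`,
R90-TF section S8 «ContSpec-n½», deal S8-R195 (i) ∕ ruling S8-R197 §2 (`exportsRow6_at_level`): ★ p863748 `chiPair_exports_of_witness` (K2E1-p15) RE-RUN on ★ (C2b)
`chiEisenstein_meromorphic_exports_level_cm_three_with_truncatedFamily` — the exports of the S8 pair block `(χ·ψ̃⁻¹, ψ)` at an ADMISSIBLE level WITH the `det`-twisted truncated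
`L²`-family (E6) (★ `truncation_twist` ∕ `truncation_mul_automorphicCharacter` + ★ `exists_L2Family_quotFun_twist`), i.e. the per-generator input of ★ `hCONT_row_of_exportsRow`
modulo the χ pole ledger.
-/
import Summits.HodgeConjecture.HodgeConjecture.Theorems.K2E1ChiEisensteinMeromorphicExportsWithTruncatedFamilyCMThree   -- ★ (C2b) p863930 (this seat): row 8 LEVEL print + (E2-bd) + (E6)
import Summits.HodgeConjecture.HodgeConjecture.Theorems.K2E1L2FamilyTwistU                                       -- ★ (t2) p864031 (this seat): `exists_L2Family_quotFun_twist`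
import Summits.HodgeConjecture.HodgeConjecture.Theorems.K2E1ChiEisensteinDetTwistU3                         -- ★ p863567 (R90-C133-p02): PAIR DET-TWIST FILE B (+ FILE A ★ p863514, ★ U2 generic twist lemmas)
import HarnessLib

/-!
# S8 (V)(i) ∕ (R)′ rows — `R90S8ChiPairExportsOfWitnessWithTruncatedFamilyU3`: ★ `chiPair_exports_of_witness` WITH THE TWISTED TRUNCATED `L²`-FAMILY (E6) — the per-generator
# «exports with the truncated family» row at an ADMISSIBLE level (ruling S8-R197)

Track B ∕ K2-LIT, crux h413 = `stmt-HodgeConjecture-24833`, route of record `HCCMUnconditional`; cell `hodgecm-mathlib`, R90-TF section S8 «ContSpec-n½» (hCONT OF RECORD, S8-R195 (i);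
J-S8-ADM, S8-R197).  THEOREMS ONLY (no `def`, no `instance`, no `notation`, no named-fact hypothesis, no `sorry`; default heartbeats); lane `--supports stmt-HodgeConjecture-24833
--as helper` (count-neutral).  CLOSES NO SOCKET.  BYTES: ★ p863748 `chiPair_exports_of_witness` (K2E1-p15) — same binders (the ADMISSIBLE LEVEL PACKAGE `hK' hKinf U₀ hU₀o hU₀c hU hVc
μa μf bV hbc hbM` at `(χ, K′, ω)`, `h2 hc hJ`, the automorphic `ψ`), same proof — with ★ `…_level_cm_three_with_bound` replaced by ★ `…_level_cm_three_with_truncatedFamily` and ONE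
more conjunct, (E6) for the TWISTED family: `∀ T ≥ 1, ∃ Fam : ℂ → Lp ℂ 2 μ, DifferentiableOn ℂ Fam Pᶜ ∧ ∀ z ∉ P, ⇑(Fam z) =ᵐ[μ] quotFun (Λ^T (fun x => Ec z x · Θ x))`, `Θ = detChar ψ`
(function level ★ `truncation_mul_automorphicCharacter`: `Λ^T(E·Θ) = Λ^T(E)·Θ`; class level ★ `exists_L2Family_quotFun_twist`: multiplication by the unit-modulus continuous
`G(F)`-invariant `Θ` is a CLM on `L²(μ)`).  This is the ∃-body of the row `hEXP6` of ★ `hCONT_row_of_exportsRow` at the pair block, MINUS the χ pole ledger `P ∩ {1<Re} ⊆ S`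
(K2E2-p12) — the ADMISSIBLE binder list printed once (S8-R197 (ii)).
* §1 **`chiPair_exports_of_witness_with_truncatedFamily`**.
HONEST LABEL: HC_CM is proved only modulo the 7 printed citations (2 remaining named inputs: hLiu418 = `stmt-HodgeConjecture-24832`, h413 = `stmt-HodgeConjecture-24833`) until
rung 0 closes; REL ≠ ★ ≠ BUILT; instantiates ★ exports and ★ transports, pays no letter by itself; count-neutral.

## References
* [BernsteinLapid2019] J. Bernstein, E. Lapid, *On the meromorphic continuation of Eisenstein series*, J. Amer. Math. Soc. 37 (2024), Thm 2.3, §4, §7.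
* [MoeglinWaldspurger1995] C. Mœglin, J.-L. Waldspurger, *Spectral Decomposition and Eisenstein Series* (1995), I.2.13, II.1.5, IV.1.8–IV.1.11, IV.2.
* [Rogawski1990] J. D. Rogawski, *Automorphic Representations of Unitary Groups in Three Variables* (1990), §13.3 p. 202.
-/

set_option autoImplicit false
set_option linter.dupNamespace false  -- the mandated namespace `…HodgeConjecture.HodgeConjecture.R90.S8` (LEAD #1 L1) repeats the summit's segment

noncomputable section

open MeasureTheory Measure Filter Topology Set NumberField IsDedekindDomain
open scoped NNReal ENNReal MatrixGroups
open Literature.MeasureTheory.Group Literature.NumberTheory Literature.NumberTheory.Automorphic Literature.NumberTheory.Automorphic.UnitaryGroup AdelicGroupData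
open Literature.NumberTheory.Automorphic.Arthur2013.Leaves.TECR
open Literature.NumberTheory.GaloisRepresentations (HeckeCharacter)
open Summit.HodgeConjecture.HodgeConjecture.Cruxes.H413.K2E1BorelEisensteinU
open Summit.HodgeConjecture.HodgeConjecture.Cruxes.H413.K2E1BLBorelSpacesU2Defs
open Summit.HodgeConjecture.HodgeConjecture.Cruxes.H413.K2E1BLBorelOperatorsU2Defs
open Summit.HodgeConjecture.HodgeConjecture.Cruxes.H413.K2E1CharacterEisensteinU2Defs
open Summit.HodgeConjecture.HodgeConjecture.Cruxes.H413.K2E1ChiSectionSpaceU2Defs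
open Summit.HodgeConjecture.HodgeConjecture.Cruxes.H413.K2E1CharacterEisensteinU3PairDefs
open Summit.HodgeConjecture.HodgeConjecture.Cruxes.H413.K2E1ChiSectionSpaceU3PairDefs
open Summit.HodgeConjecture.HodgeConjecture.Cruxes.H413.K2E1ChiEisensteinMeromorphicExportsWithTruncatedFamilyCMThree (chiEisenstein_meromorphic_exports_level_cm_three_with_truncatedFamily)
open Summit.HodgeConjecture.HodgeConjecture.Cruxes.H413.K2E1L2FamilyTwistU (exists_L2Family_quotFun_twist)
open Summit.HodgeConjecture.HodgeConjecture.Cruxes.H413.K2E1ChiDetCharBorelU3 (mul_detChar_mem_chiSectionSpacePair)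
open Summit.HodgeConjecture.HodgeConjecture.Cruxes.H413.K2E1ChiEisensteinDetTwistU2 (eisensteinSeriesU_flatSectionU_mul_automorphicCharacter differentiableOn_twist continuous_twist locally_bounded_twist truncation_mul_automorphicCharacter)

namespace Summit.HodgeConjecture.HodgeConjecture.R90.S8

variable (L : Type) [Field L] [NumberField L] [IsCMField L]
  [MeasurableSpace (quasiSplit (↥(maximalRealSubfield L)) L (IsCMField.complexConj L) 3).Adelic] [BorelSpace (quasiSplit (↥(maximalRealSubfield L)) L (IsCMField.complexConj L) 3).Adelic]
  [MeasurableSpace (arch (↥(maximalRealSubfield L)) L (IsCMField.complexConj L) 3 ((StdForm.antidiagonal 3).over L))] [BorelSpace (arch (↥(maximalRealSubfield L)) L (IsCMField.complexConj L) 3 ((StdForm.antidiagonal 3).over L))]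
  [MeasurableSpace (finAdelic (↥(maximalRealSubfield L)) L (IsCMField.complexConj L) 3 ((StdForm.antidiagonal 3).over L))] [BorelSpace (finAdelic (↥(maximalRealSubfield L)) L (IsCMField.complexConj L) 3 ((StdForm.antidiagonal 3).over L))]

/-! ## §1 The exports at an admissible pair block, with the twisted truncated family -/

/-- **THE `χ`-EISENSTEIN EXPORTS AT THE PAIR BLOCK `(χ·ψ̃⁻¹, ψ)`, WITH THE TWISTED TRUNCATED `L²`-FAMILY** (★ row 8 LEVEL print WITH TRUNCATED FAMILY at `(χ, 1)` ∘ ★ PAIR DET-TWIST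
`Θ = detChar ψ` ∘ ★ `truncation_mul_automorphicCharacter` ∘ ★ `exists_L2Family_quotFun_twist`): for a continuous bounded `φ ∈ V(χ, K′, ω)` at a
level `K′ ∋ ι(K_∞)`, `K′ ≤ K`, with `ω` trivial on an open compact `U₀`-part, continuous sections and a continuous bounded basis of `V(χʷ, K′, ω)`, and an automorphic `ψ` of
`U(1)(𝔸_{L⁺})`: there are scattering coordinates `q_j` (holomorphic on `{2 < Re}`, `hqφ`), their continuations `qc_j`, the continued family `Ec` and ONE closed co-discrete pole set
`P ⊆ {Re ≤ 2}` such that, for the TWISTED section `φΘ ∈ V(χ·ψ̃⁻¹, ψ; K′, ω·Θ)` (continuous), `Ec·Θ` continues `z ↦ E((φΘ)_z)` (tube identity on `{2 < Re}`), is holomorphic in `z` off `P`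
for every `g`, continuous in `g` off `P` (E4), LOCALLY JOINTLY BOUNDED off `P` (E2-bd), and (E6) for every `T ≥ 1` the class `z ↦ [Λ^T(Ec(z)·Θ)] ∈ L²(μ)` of the truncated
twisted family is (represented by) an `L²(μ)`-valued HOLOMORPHIC family off `P`.
[cite: BernsteinLapid2019, Thm 2.3, §4, §7] [cite: MoeglinWaldspurger1995, II.1.5, IV.1.8–IV.1.11] [cite: Rogawski1990, §13.3 p. 202] -/
theorem chiPair_exports_of_witness_with_truncatedFamily
    (μ : Measure (quasiSplit (↥(maximalRealSubfield L)) L (IsCMField.complexConj L) 3).automorphicQuotient) [(quasiSplit (↥(maximalRealSubfield L)) L (IsCMField.complexConj L) 3).IsAutomorphicMeasure μ]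
    (νG : Measure (quasiSplit (↥(maximalRealSubfield L)) L (IsCMField.complexConj L) 3).Adelic) [νG.IsHaarMeasure] [νG.IsInvInvariant] [SFinite νG]
    (ν : Measure ↥(adelicUnipotent (↥(maximalRealSubfield L)) L (IsCMField.complexConj L) 3)) [ν.IsHaarMeasure] [ν.IsMulRightInvariant] [ν.IsInvInvariant]
    {𝓕 : Set ↥(adelicUnipotent (↥(maximalRealSubfield L)) L (IsCMField.complexConj L) 3)}
    (h𝓕N : IsFundamentalDomain ↥(rationalUnipotent (↥(maximalRealSubfield L)) L (IsCMField.complexConj L) 3) 𝓕 ν) (h𝓕c : IsCompact (closure 𝓕)) (h𝓕₀ : ν 𝓕 ≠ 0)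
    {β : (quasiSplit (↥(maximalRealSubfield L)) L (IsCMField.complexConj L) 3).Adelic → ℝ≥0∞}
    (hβ : IsCoveringWeight ↥((arithmeticBorel (↥(maximalRealSubfield L)) L (IsCMField.complexConj L) 3).map (quasiSplit (↥(maximalRealSubfield L)) L (IsCMField.complexConj L) 3).arithmeticSubgroup.subtype) β)
    {μZ : Measure (borelQuotient (↥(maximalRealSubfield L)) L (IsCMField.complexConj L) 3)} [SFinite μZ]
    (hμZ : ∀ f : borelQuotient (↥(maximalRealSubfield L)) L (IsCMField.complexConj L) 3 → ℝ≥0∞, Measurable f → ∫⁻ z, f z ∂μZ = ∫⁻ g, β g * f (toBorelQuotient (↥(maximalRealSubfield L)) L (IsCMField.complexConj L) 3 g) ∂νG)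
    -- the M1 family: `φ ∈ V(χ, K, 1)` continuous bounded with `φ ∘ ι_∞ = φ(1)`, and a basis of `V(χʷ, K, 1)` by continuous bounded functions
    {χ : HeckeCharacter L} {K' : Subgroup (quasiSplit (↥(maximalRealSubfield L)) L (IsCMField.complexConj L) 3).Adelic} {ω : ↥K' → ℂ} {φ : (quasiSplit (↥(maximalRealSubfield L)) L (IsCMField.complexConj L) 3).Adelic → ℂ} (hφV : φ ∈ chiSectionSpace χ K' ω) (hφc : Continuous φ) {Mφ : ℝ} (hφM : ∀ x, ‖φ x‖ ≤ Mφ)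
    -- the LEVEL: `K′ ≤ K`, `ι(K_∞) ⊆ K′`, an open compact `U₀` with `ι_f(U₀ ∩ G_f) ⊆ K′` on which `ω = 1`, continuity of the sections; auxiliary Haar measures on `G_∞` (two-sided) and `G(𝔸_f)`
    (hK' : K' ≤ ((standardMaximalCompactGL 3 L).comap (adelicVal (↥(maximalRealSubfield L)) L (IsCMField.complexConj L) 3 ((StdForm.antidiagonal 3).over L)) : Subgroup (quasiSplit (↥(maximalRealSubfield L)) L (IsCMField.complexConj L) 3).Adelic))
    (hKinf : ∀ k : arch (↥(maximalRealSubfield L)) L (IsCMField.complexConj L) 3 ((StdForm.antidiagonal 3).over L), adelicVal (↥(maximalRealSubfield L)) L (IsCMField.complexConj L) 3 ((StdForm.antidiagonal 3).over L) (archToAdelic (↥(maximalRealSubfield L)) L (IsCMField.complexConj L) 3 _ k) ∈ standardMaximalCompactGL 3 L →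
      archToAdelic (↥(maximalRealSubfield L)) L (IsCMField.complexConj L) 3 _ k ∈ K')
    (U₀ : Subgroup (GL (Fin 3) (FiniteAdeleRing (𝓞 L) L))) (hU₀o : IsOpen (U₀ : Set (GL (Fin 3) (FiniteAdeleRing (𝓞 L) L)))) (hU₀c : IsCompact (U₀ : Set (GL (Fin 3) (FiniteAdeleRing (𝓞 L) L))))
    (hU : ∀ b : finAdelic (↥(maximalRealSubfield L)) L (IsCMField.complexConj L) 3 ((StdForm.antidiagonal 3).over L), (b : GL (Fin 3) (FiniteAdeleRing (𝓞 L) L)) ∈ U₀ →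
      ∃ hb : finAdelicToAdelic (↥(maximalRealSubfield L)) L (IsCMField.complexConj L) 3 ((StdForm.antidiagonal 3).over L) b ∈ K', ω ⟨_, hb⟩ = 1)
    (hVc : ∀ φ ∈ chiSectionSpace χ K' ω, Continuous φ)
    (μa : Measure (arch (↥(maximalRealSubfield L)) L (IsCMField.complexConj L) 3 ((StdForm.antidiagonal 3).over L))) [μa.IsHaarMeasure] [μa.IsMulRightInvariant]
    (μf : Measure (finAdelic (↥(maximalRealSubfield L)) L (IsCMField.complexConj L) 3 ((StdForm.antidiagonal 3).over L))) [μf.IsHaarMeasure]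
    {ι' : Type} [Fintype ι'] [DecidableEq ι'] (bV : Module.Basis ι' ℂ ↥(chiSectionSpace (reflectChar (IsCMField.complexConj L) χ) K' ω))
    (hbc : ∀ j, Continuous ((bV j : ↥(chiSectionSpace (reflectChar (IsCMField.complexConj L) χ) K' ω)) : (quasiSplit (↥(maximalRealSubfield L)) L (IsCMField.complexConj L) 3).Adelic → ℂ)) {Mb : ℝ} (hbM : ∀ j x, ‖((bV j : ↥(chiSectionSpace (reflectChar (IsCMField.complexConj L) χ) K' ω)) : (quasiSplit (↥(maximalRealSubfield L)) L (IsCMField.complexConj L) 3).Adelic → ℂ) x‖ ≤ Mb)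
    (h2 : Module.finrank (↥(maximalRealSubfield L)) L = 2) (hc : IsCMField.complexConj L ≠ 1) (hJ : ((StdForm.antidiagonal 3).over L).det ≠ 0)
    (ψ : ↥(TorusDict.torus (IsCMField.complexConj L)) →ₜ* ℂˣ) (hψ : TorusDict.IsAutomorphic (IsCMField.complexConj L) ψ) :
    ∃ (q : ι' → ℂ → ℂ) (Ec : ℂ → (quasiSplit (↥(maximalRealSubfield L)) L (IsCMField.complexConj L) 3).Adelic → ℂ) (qc : ι' → ℂ → ℂ) (P : Set ℂ),
      -- the untwisted scalar rows and the pole set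
      (∀ j, DifferentiableOn ℂ (q j) {z : ℂ | 2 < z.re}) ∧
      (∀ z : ℂ, 2 < z.re → (∑ j, q j z • ((bV j : ↥(chiSectionSpace (reflectChar (IsCMField.complexConj L) χ) K' ω)) : (quasiSplit (↥(maximalRealSubfield L)) L (IsCMField.complexConj L) 3).Adelic → ℂ)) = ((((ν 𝓕).toReal⁻¹ : ℝ)) : ℂ) • (fun g : (quasiSplit (↥(maximalRealSubfield L)) L (IsCMField.complexConj L) 3).Adelic => (∫ v : ↥(adelicUnipotent (↥(maximalRealSubfield L)) L (IsCMField.complexConj L) 3), flatSectionU φ z ((quasiSplit (↥(maximalRealSubfield L)) L (IsCMField.complexConj L) 3).toAdelic (weylLongU ((IsCMField.complexConj L : L ≃ₐ[↥(maximalRealSubfield L)] L) : L →+* L) (rfl : (StdForm.antidiagonal 3).over L = (StdForm.antidiagonal 3).over L)) * ((v : (quasiSplit (↥(maximalRealSubfield L)) L (IsCMField.complexConj L) 3).Adelic) * g)) ∂ν) * (((borelHeight g : ℝ) : ℂ) ^ (z - 2)))) ∧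
      (∀ z : ℂ, 2 < z.re → Ec z = eisensteinSeriesU (flatSectionU φ z)) ∧ (∀ j (z : ℂ), 2 < z.re → qc j z = q j z) ∧
      IsClosed P ∧ (∀ z₀ : ℂ, ∀ᶠ s in 𝓝[≠] z₀, s ∉ P) ∧ (∀ z ∈ P, z.re ≤ 2) ∧ (∀ j (z : ℂ), z ∉ P → AnalyticAt ℂ (qc j) z) ∧
      -- the twisted pair block `(χ·ψ̃⁻¹, ψ)`: section, tube identity, holomorphy, (E4), (E2-bd) for `Ec·Θ`
      (fun x => φ x * ((detChar (↥(maximalRealSubfield L)) L (IsCMField.complexConj L) h2 hc 3 ((StdForm.antidiagonal 3).over L) ψ hψ hJ x : ℂˣ) : ℂ)) ∈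
        chiSectionSpacePair (χ * (TorusDict.pullback (IsCMField.complexConj L) h2 hc ψ hψ)⁻¹) ((1 : ↥(TorusDict.torus (IsCMField.complexConj L)) →ₜ* ℂˣ) * ψ) K'
          (fun k => ω k * ((detChar (↥(maximalRealSubfield L)) L (IsCMField.complexConj L) h2 hc 3 ((StdForm.antidiagonal 3).over L) ψ hψ hJ (k : (quasiSplit (↥(maximalRealSubfield L)) L (IsCMField.complexConj L) 3).Adelic) : ℂˣ) : ℂ)) ∧
      Continuous (fun x => φ x * ((detChar (↥(maximalRealSubfield L)) L (IsCMField.complexConj L) h2 hc 3 ((StdForm.antidiagonal 3).over L) ψ hψ hJ x : ℂˣ) : ℂ)) ∧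
      (∀ z : ℂ, 2 < z.re → (fun x => Ec z x * ((detChar (↥(maximalRealSubfield L)) L (IsCMField.complexConj L) h2 hc 3 ((StdForm.antidiagonal 3).over L) ψ hψ hJ x : ℂˣ) : ℂ)) = eisensteinSeriesU (flatSectionU (fun x => φ x * ((detChar (↥(maximalRealSubfield L)) L (IsCMField.complexConj L) h2 hc 3 ((StdForm.antidiagonal 3).over L) ψ hψ hJ x : ℂˣ) : ℂ)) z)) ∧
      (∀ g (z : ℂ), z ∉ P → AnalyticAt ℂ (fun z => Ec z g * ((detChar (↥(maximalRealSubfield L)) L (IsCMField.complexConj L) h2 hc 3 ((StdForm.antidiagonal 3).over L) ψ hψ hJ g : ℂˣ) : ℂ)) z) ∧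
      (∀ g, DifferentiableOn ℂ (fun z => Ec z g * ((detChar (↥(maximalRealSubfield L)) L (IsCMField.complexConj L) h2 hc 3 ((StdForm.antidiagonal 3).over L) ψ hψ hJ g : ℂˣ) : ℂ)) Pᶜ) ∧
      (∀ z : ℂ, z ∉ P → Continuous (fun x => Ec z x * ((detChar (↥(maximalRealSubfield L)) L (IsCMField.complexConj L) h2 hc 3 ((StdForm.antidiagonal 3).over L) ψ hψ hJ x : ℂˣ) : ℂ))) ∧
      (∀ z₁ : ℂ, z₁ ∉ P → ∀ K : Set (quasiSplit (↥(maximalRealSubfield L)) L (IsCMField.complexConj L) 3).Adelic, IsCompact K → ∃ V ∈ 𝓝 z₁, ∃ M : ℝ, ∀ z ∈ V, ∀ g ∈ K, ‖Ec z g * ((detChar (↥(maximalRealSubfield L)) L (IsCMField.complexConj L) h2 hc 3 ((StdForm.antidiagonal 3).over L) ψ hψ hJ g : ℂˣ) : ℂ)‖ ≤ M) ∧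
      -- (E6) THE TWISTED TRUNCATED FAMILY IS `L²`-HOLOMORPHIC OFF `P`, AT EVERY LEVEL `T ≥ 1`
      (∀ T : ℝ≥0, 1 ≤ T → ∃ Fam : ℂ → Lp ℂ 2 μ, DifferentiableOn ℂ Fam Pᶜ ∧
        ∀ z : ℂ, z ∉ P → ((Fam z : Lp ℂ 2 μ) : (quasiSplit (↥(maximalRealSubfield L)) L (IsCMField.complexConj L) 3).automorphicQuotient → ℂ) =ᵐ[μ]
          (quasiSplit (↥(maximalRealSubfield L)) L (IsCMField.complexConj L) 3).quotFun (truncation ν 𝓕 T (fun x => Ec z x * ((detChar (↥(maximalRealSubfield L)) L (IsCMField.complexConj L) h2 hc 3 ((StdForm.antidiagonal 3).over L) ψ hψ hJ x : ℂˣ) : ℂ)))) := by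
  obtain ⟨q, Ec, qc, P, hq, hqφ, -, -, hE2, hqcq, hPc, hPcd, hPre, hEan, hqan, hEdiff, -, hE4, hEbd, hE6⟩ :=
    chiEisenstein_meromorphic_exports_level_cm_three_with_truncatedFamily L μ νG ν h𝓕N h𝓕c h𝓕₀ hβ hμZ hφV hφc hφM hK' hKinf U₀ hU₀o hU₀c hU hVc μa μf bV hbc hbM
  -- the untwisted section in the pair currency at `χ₂ = 1`
  have hφ1 : φ ∈ chiSectionSpacePair χ (1 : ↥(TorusDict.torus (IsCMField.complexConj L)) →ₜ* ℂˣ) K' ω := by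
    rw [chiSectionSpacePair_one]; exact hφV
  -- (E6) twisted: `Λ^T(Ec·Θ) = Λ^T(Ec)·Θ` (★ `truncation_mul_automorphicCharacter`) and the class-level twist by the unit-modulus `G(F)`-invariant `Θ` (★ `exists_L2Family_quotFun_twist`)
  have hE6Θ : ∀ T : ℝ≥0, 1 ≤ T → ∃ Fam : ℂ → Lp ℂ 2 μ, DifferentiableOn ℂ Fam Pᶜ ∧
      ∀ z : ℂ, z ∉ P → ((Fam z : Lp ℂ 2 μ) : (quasiSplit (↥(maximalRealSubfield L)) L (IsCMField.complexConj L) 3).automorphicQuotient → ℂ) =ᵐ[μ]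
        (quasiSplit (↥(maximalRealSubfield L)) L (IsCMField.complexConj L) 3).quotFun (truncation ν 𝓕 T (fun x => Ec z x * ((detChar (↥(maximalRealSubfield L)) L (IsCMField.complexConj L) h2 hc 3 ((StdForm.antidiagonal 3).over L) ψ hψ hJ x : ℂˣ) : ℂ))) := by
    intro T hT
    -- `Θ := det`-character of `ψ`: continuous, `‖Θ‖ = 1`, trivial on `G(F) = quotientSubgroup`
    set Θ := (detChar (↥(maximalRealSubfield L)) L (IsCMField.complexConj L) h2 hc 3 ((StdForm.antidiagonal 3).over L) ψ hψ hJ)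
    obtain ⟨Fam', hFd', hFam'⟩ := exists_L2Family_quotFun_twist (quasiSplit (↥(maximalRealSubfield L)) L (IsCMField.complexConj L) 3) μ (θ := fun x => ((Θ x : ℂˣ) : ℂ)) Θ.continuous (C := 1)
      (fun g => (Θ.norm_coe g).le) (fun γ hγ g => by show ((Θ (γ * g) : ℂˣ) : ℂ) = ((Θ g : ℂˣ) : ℂ); rw [map_mul, Θ.map_of_mem hγ, one_mul]) (D := Pᶜ)
      (fun z => truncation ν 𝓕 T (Ec z)) (hE6 T hT)
    refine ⟨Fam', hFd', fun z hz => ?_⟩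
    have htw : truncation ν 𝓕 T (fun x => Ec z x * ((Θ x : ℂˣ) : ℂ)) = fun g => truncation ν 𝓕 T (Ec z) g * ((Θ g : ℂˣ) : ℂ) :=
      funext fun g => truncation_mul_automorphicCharacter L (by norm_num) ν 𝓕 T Θ (Ec z) g
    rw [htw]
    exact hFam' z hz
  refine ⟨q, Ec, qc, P, hq, hqφ, hE2, hqcq, hPc, hPcd, hPre, hqan,
    mul_detChar_mem_chiSectionSpacePair h2 hc hJ ψ hψ hφ1,
    hφc.mul (detChar (↥(maximalRealSubfield L)) L (IsCMField.complexConj L) h2 hc 3 ((StdForm.antidiagonal 3).over L) ψ hψ hJ).continuous,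
    fun z hz => ?_, fun g z hz => (hEan g z hz).mul analyticAt_const,
    differentiableOn_twist Ec hEdiff _,
    fun z hz => continuous_twist Ec (D := Pᶜ) (fun z hz => hE4 z hz) (detChar (↥(maximalRealSubfield L)) L (IsCMField.complexConj L) h2 hc 3 ((StdForm.antidiagonal 3).over L) ψ hψ hJ) z hz,
    fun z₁ hz₁ K hK => locally_bounded_twist Ec (D := Pᶜ) (fun z hz => hEbd z hz) (detChar (↥(maximalRealSubfield L)) L (IsCMField.complexConj L) h2 hc 3 ((StdForm.antidiagonal 3).over L) ψ hψ hJ) z₁ hz₁ K hK, hE6Θ⟩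
  funext x
  rw [hE2 z hz, eisensteinSeriesU_flatSectionU_mul_automorphicCharacter]

end Summit.HodgeConjecture.HodgeConjecture.R90.S8

end
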